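import Summits.QuantumFields.GaugeBoot.Certificates.SparseReducedWalk
import HarnessLib

/-!
# Sparse certificate replay, part 6: the aggregated-equality form (gauge-boot L4 support)

HONEST FRAMING (cell `pub-gaugeboot`): certified bounds on lattice expectations at stated coupling,
gauge group, dimension and torus size; NOT a mass gap, NOT a continuum limit, NOT a string tension;
NOT Yang–Mills-summit-bearing (barriers `FixedCouplingUltralocality`, `PerturbativeInvisibility`).

Lead ruling A126 (2)(c) / A137 (1)(iii): a certificate uses its equality rows only through the single
combination `Σ_e λ_e · row_e`.  For families whose rows are expensive to bind one by one (the KZ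
rows C1–C2, C15–C19: ≈ 10⁵ rationals per β in the per-row span witnesses) the lattice binding proves
ONE aggregated equality `Σ_v a_v y_v = a₀` with `a = Σ_e λ_e row_e`, `a₀ = Σ_e λ_e rhs_e` instead of
all rows.  This file: the aggregated row as emitted DATA `RA` (dense) / `rhsA`, re-checked in the
kernel against the multipliers and the column table by a linear walk (`aggWalk`, `AggOK`), the dense →
sparse conversion `zipIdx` (so that part 2's `objective_bound₂` applies with ONE row), and the
assembled bound `objective_bound_agg`: same conclusion as `objective_bound₂`, with the row hypotheses
replaced by `hagg : Σ_v RA[v] · y_v = rhsA`.  All `[folklore]`.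
-/

namespace Summit.QuantumFields.GaugeBoot.Certificates.Sparse

open Matrix Finset Literature.Computation.Certificates

noncomputable section

/-! ## Dense rows as sparse rows -/

/-- `zipIdx i [a₀, a₁, …] = [(i, a₀), (i+1, a₁), …]`. [folklore] -/
def zipIdx : ℕ → List ℚ → List (ℕ × ℚ)
  | _, [] => []
  | i, a :: as => (i, a) :: zipIdx (i + 1) as

/-- First-match lookup in an indexed dense row. [folklore] -/
theorem sget_zipIdx : ∀ (l : List ℚ) (i v : ℕ),
    sget (zipIdx i l) v = if i ≤ v then l.getD (v - i) 0 else 0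
  | [], i, v => by simp [zipIdx, sget]
  | a :: as, i, v => by
      rw [zipIdx, sget]
      by_cases h : i = v
      · subst h; simp
      · have hb : (i == v) = false := beq_eq_false_iff_ne.mpr h
        rw [hb, cond_false, sget_zipIdx as (i + 1) v]
        by_cases h1 : i + 1 ≤ v
        · rw [if_pos h1, if_pos (by omega), show v - i = (v - (i + 1)) + 1 by omega, List.getD_cons_succ]
        · rw [if_neg h1]
          by_cases h2 : i ≤ v
          · exact absurd (show i = v by omega) h
          · rw [if_neg h2]

/-- Lookup from index `0`. [folklore] -/
theorem sget_zipIdx_zero (l : List ℚ) (v : ℕ) : sget (zipIdx 0 l) v = l.getD v 0 := by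
  rw [sget_zipIdx]; simp

/-! ## The aggregated row, checked by a linear walk -/

/-- Walk `n` steps over the dense aggregated row from variable `v`, checking
`RA[v] = Σ_{(e,c) ∈ CT[v]} λ_e c`. [folklore] -/
def aggWalkN (LM : List ℚ) (CT2 : List (List (List (ℕ × ℚ)))) (B : ℕ) : ℕ → List ℚ → ℕ → Bool
  | 0, _, _ => true
  | _ + 1, [], _ => false
  | n + 1, a :: as, v => (lamDotC LM (getC CT2 B v) == a) && aggWalkN LM CT2 B n as (v + 1)

/-- What the walk establishes, relative to the walked list. [folklore] -/
theorem aggWalkN_sound {LM : List ℚ} {CT2 : List (List (List (ℕ × ℚ)))} {B : ℕ} :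
    ∀ {n : ℕ} {As : List ℚ} {v : ℕ}, aggWalkN LM CT2 B n As v = true →
      ∀ u < n, lamDotC LM (getC CT2 B (v + u)) = As.getD u 0
  | 0, _, _, _, u, hu => absurd hu (Nat.not_lt_zero _)
  | n + 1, [], _, h, _, _ => by simp [aggWalkN] at h
  | n + 1, a :: as, v, h, u, hu => by
      simp only [aggWalkN, Bool.and_eq_true, beq_iff_eq] at h
      cases u with
      | zero => simpa using h.1
      | succ u =>
          have := aggWalkN_sound h.2 u (by omega)
          rw [List.getD_cons_succ, show v + (u + 1) = v + 1 + u by omega]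
          exact this

/-- Aggregated-row walk over the variables `lo ≤ v < hi`. [folklore] -/
def aggWalk (LM : List ℚ) (CT2 : List (List (List (ℕ × ℚ)))) (B : ℕ) (RA : List ℚ) (lo hi : ℕ) :
    Bool :=
  aggWalkN LM CT2 B (hi - lo) (RA.drop lo) lo

/-- What the aggregated-row checks establish: `RA[v] = Σ_e λ_e row_e[v]`. [folklore] -/
def AggOK (LM : List ℚ) (RW : List (ℚ × List (ℕ × ℚ))) (RA : List ℚ) (lo hi : ℕ) : Prop :=
  ∀ v, lo ≤ v → v < hi → lamDot₂ LM RW v = RA.getD v 0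

/-- **Soundness of the aggregated-row walk** (with sound column / row tables). [folklore] -/
theorem aggOK_of_walk {LM : List ℚ} {RW : List (ℚ × List (ℕ × ℚ))} {CT2 : List (List (List (ℕ × ℚ)))}
    {B ne nv lo hi : ℕ} {RA : List ℚ} (hLM : LM.length ≤ ne) (hcol : ColOK RW CT2 B ne 0 nv)
    (hrow : RowOK RW CT2 B 0 ne) (hhi : hi ≤ nv) (h : aggWalk LM CT2 B RA lo hi = true) :
    AggOK LM RW RA lo hi := by
  intro v hlo hvi
  have hw := aggWalkN_sound h (v - lo) (by omega)
  rw [getD_drop, show lo + (v - lo) = v by omega] at hw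
  rw [lamDot₂_eq_lamDotC hLM hcol hrow (lt_of_lt_of_le hvi hhi), hw]

/-- Concatenating variable ranges. [folklore] -/
theorem AggOK.append {LM : List ℚ} {RW : List (ℚ × List (ℕ × ℚ))} {RA : List ℚ} {lo mid hi : ℕ}
    (h1 : AggOK LM RW RA lo mid) (h2 : AggOK LM RW RA mid hi) : AggOK LM RW RA lo hi :=
  fun v hlo hhi => if hm : v < mid then h1 v hlo hm else h2 v (Nat.le_of_not_lt hm) hhi

/-! ## The assembled abstract bound, aggregated form -/

/-- **Certified lower bound on the objective, aggregated-equality form.**  Same data and kernel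
checks as `objective_bound₂` (residual table `R` against the multipliers `LM` and rows `RW`, final
identity), plus the aggregated row `RA` (`AggOK`) and its right-hand side `rhsA = Σ_e λ_e rhs_e`;
the hypotheses on `y` are `y_0 = 1`, `|y_v| ≤ 1`, the ONE aggregated equality
`Σ_v RA[v] y_v = rhsA`, and the PSD blocks.  (Proof: `objective_bound₂` with the single row
`(rhsA, RA)` and multiplier `1`.) [folklore] -/
theorem objective_bound_agg {nv : ℕ} (cL : List (ℕ × ℚ)) (LM : List ℚ)
    (RW : List (ℚ × List (ℕ × ℚ))) (TS : List (ℕ × List ℤ)) (R : List ℚ) (RA : List ℚ)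
    (rhsA lower : ℚ) (hres : ResidOK₂ cL LM RW TS R 0 (nv + 1))
    (hfin : finalCheck₂ LM RW R (nv + 1) lower = true) (hagg0 : AggOK LM RW RA 0 (nv + 1))
    (hrhs : lamRhs₂ LM RW = rhsA)
    {K : Type*} [Fintype K] {σ : K → Type*} [∀ k, Fintype (σ k)] [∀ k, DecidableEq (σ k)]
    (F : ∀ k, Fin (nv + 1) → Matrix (σ k) (σ k) ℝ) (Z : ∀ k, Matrix (σ k) (σ k) ℝ)
    (hZ : ∀ k, (Z k).PosSemidef)
    (htr : ∀ v : Fin (nv + 1), ∑ k, trace (Z k * F k v) = ((traceTerm TS v.val : ℚ) : ℝ))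
    {y : Fin (nv + 1) → ℝ} (hy0 : y 0 = 1) (hρ : ∀ v : Fin (nv + 1), v ≠ 0 → |y v| ≤ 1)
    (hagg : ∑ v : Fin (nv + 1), ((RA.getD v.val 0 : ℚ) : ℝ) * y v = ((rhsA : ℚ) : ℝ))
    (hpsd : ∀ k, (∑ v, y v • F k v).PosSemidef) :
    ((lower : ℚ) : ℝ) ≤ ∑ v : Fin (nv + 1), ((sget cL v.val : ℚ) : ℝ) * y v := by
  -- the single aggregated row
  have hres1 : ResidOK₂ cL [1] [(rhsA, zipIdx 0 RA)] TS R 0 (nv + 1) := by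
    intro v hlo hhi
    rw [← hres v hlo hhi, resid₂, resid₂, hagg0 v hlo hhi]
    simp [lamDot₂, sget_zipIdx_zero]
  have hfin1 : finalCheck₂ [1] [(rhsA, zipIdx 0 RA)] R (nv + 1) lower = true := by
    rw [finalCheck₂, beq_iff_eq] at hfin ⊢
    rw [← hfin, ← hrhs]
    simp [lamRhs₂]
  refine objective_bound₂ cL [1] [(rhsA, zipIdx 0 RA)] TS R lower (ne := 1) (by simp) hres1 hfin1
    F Z hZ htr hy0 hρ (fun e => ?_) hpsd
  have he : e = 0 := Subsingleton.elim _ _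
  subst he
  simpa [dRow₂, sget_zipIdx_zero] using hagg

end

end Summit.QuantumFields.GaugeBoot.Certificates.Sparse
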